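import Mathlib
import Summits.Ventures.PercRepro.TriangleCapTwoTrianglesEightB

/-!
# PercRepro — THE REFINED FAR COUNT AROUND THREE TRIANGLES (p3, gen 37; part 61)

The far count of TriangleCapTwoTrianglesEightB for `S = T₁ ∪ T₂ ∪ T₃`, three three-cliques pairwise sharing at
most one vertex: the block `S × S` dominates the three triangle blocks (`block_inside_ge_three`), and
**`three_triangles_far_count`**: `Σ_p deficit(p) + 4 Σ_{T₁} degIn S + 4 Σ_{T₂} degIn S + 4 Σ_{T₃} degIn S +
4 Σ_{z ∉ S} W(z) + 2 Σ_{z ∉ S} (degIn S z)² + 2 Σ_{z ∉ S} degIn S z · degIn Sᶜ z ≥ |Sᶜ| Q + 18 (|S| + 1) +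
2 |S| Σ_{z ∉ S} degIn S z + |S| Σ_{z ∉ S} degIn Sᶜ z`.
Axioms: standard.
-/

namespace PercRepro

namespace TriangleCap

namespace C047

open Finset

variable {V : Type*} [Fintype V] [DecidableEq V]

omit [Fintype V] in
/-- The block `S × S` dominates the three triangle blocks when the triangles pairwise share at most one vertex. -/
theorem block_inside_ge_three (D : SimpleGraph V) [DecidableRel D.Adj] (T₁ T₂ T₃ : Finset V)
    (h12 : (T₁ ∩ T₂).card ≤ 1) (h13 : (T₁ ∩ T₃).card ≤ 1) (h23 : (T₂ ∩ T₃).card ≤ 1) (G : V → V → ℕ) :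
    (∑ x ∈ T₁, ∑ y ∈ T₁, if D.Adj x y then G x y else 0) +
      (∑ x ∈ T₂, ∑ y ∈ T₂, if D.Adj x y then G x y else 0) +
      (∑ x ∈ T₃, ∑ y ∈ T₃, if D.Adj x y then G x y else 0) ≤
      ∑ x ∈ T₁ ∪ T₂ ∪ T₃, ∑ y ∈ T₁ ∪ T₂ ∪ T₃, if D.Adj x y then G x y else 0 := by
  rw [← sum_product', ← sum_product', ← sum_product', ← sum_product']
  -- a sum over a subset of a diagonal product vanishes
  have hdiag : ∀ (A B : Finset V), (A ∩ B).card ≤ 1 →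
      ∑ p ∈ (A ×ˢ A) ∩ (B ×ˢ B), (if D.Adj p.1 p.2 then G p.1 p.2 else 0) = 0 := by
    intro A B hAB
    apply sum_eq_zero
    intro p hp
    rw [mem_inter, mem_product, mem_product] at hp
    have hp1 : p.1 ∈ A ∩ B := mem_inter.mpr ⟨hp.1.1, hp.2.1⟩
    have hp2 : p.2 ∈ A ∩ B := mem_inter.mpr ⟨hp.1.2, hp.2.2⟩
    have heq : p.1 = p.2 := card_le_one.mp hAB p.1 hp1 p.2 hp2
    simp only [heq, SimpleGraph.irrefl, if_false]
  have e12 := sum_union_inter (s₁ := T₁ ×ˢ T₁) (s₂ := T₂ ×ˢ T₂)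
    (f := fun p : V × V => if D.Adj p.1 p.2 then G p.1 p.2 else 0)
  rw [hdiag T₁ T₂ h12, add_zero] at e12
  have e3 := sum_union_inter (s₁ := (T₁ ×ˢ T₁) ∪ (T₂ ×ˢ T₂)) (s₂ := T₃ ×ˢ T₃)
    (f := fun p : V × V => if D.Adj p.1 p.2 then G p.1 p.2 else 0)
  have hz : ∑ p ∈ ((T₁ ×ˢ T₁) ∪ (T₂ ×ˢ T₂)) ∩ (T₃ ×ˢ T₃), (if D.Adj p.1 p.2 then G p.1 p.2 else 0) = 0 := by
    rw [union_inter_distrib_right]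
    have := sum_union_inter (s₁ := (T₁ ×ˢ T₁) ∩ (T₃ ×ˢ T₃)) (s₂ := (T₂ ×ˢ T₂) ∩ (T₃ ×ˢ T₃))
      (f := fun p : V × V => if D.Adj p.1 p.2 then G p.1 p.2 else 0)
    rw [hdiag T₁ T₃ h13, hdiag T₂ T₃ h23] at this
    omega
  rw [hz, add_zero] at e3
  have hsub : ∑ p ∈ ((T₁ ×ˢ T₁) ∪ (T₂ ×ˢ T₂)) ∪ (T₃ ×ˢ T₃), (if D.Adj p.1 p.2 then G p.1 p.2 else 0) ≤
      ∑ p ∈ (T₁ ∪ T₂ ∪ T₃) ×ˢ (T₁ ∪ T₂ ∪ T₃), (if D.Adj p.1 p.2 then G p.1 p.2 else 0) := by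
    apply sum_le_sum_of_subset_of_nonneg
    · intro p hp
      rw [mem_union, mem_union, mem_product, mem_product, mem_product] at hp
      rw [mem_product, mem_union, mem_union, mem_union, mem_union]
      rcases hp with (hp | hp) | hp
      · exact ⟨Or.inl (Or.inl hp.1), Or.inl (Or.inl hp.2)⟩
      · exact ⟨Or.inl (Or.inr hp.1), Or.inl (Or.inr hp.2)⟩
      · exact ⟨Or.inr hp.1, Or.inr hp.2⟩
    · intro _ _ _
      exact Nat.zero_le _
  omega

/-- **THE REFINED FAR COUNT AROUND THREE TRIANGLES** (`S = T₁ ∪ T₂ ∪ T₃`, three-cliques pairwise sharing at most one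
vertex). -/
theorem three_triangles_far_count (D : SimpleGraph V) [DecidableRel D.Adj] (T₁ T₂ T₃ : Finset V)
    (h₁ : T₁.card = 3) (h₂ : T₂.card = 3) (h₃ : T₃.card = 3)
    (h12 : (T₁ ∩ T₂).card ≤ 1) (h13 : (T₁ ∩ T₃).card ≤ 1) (h23 : (T₂ ∩ T₃).card ≤ 1)
    (hcl₁ : ∀ x ∈ T₁, ∀ y ∈ T₁, x ≠ y → D.Adj x y) (hcl₂ : ∀ x ∈ T₂, ∀ y ∈ T₂, x ≠ y → D.Adj x y)
    (hcl₃ : ∀ x ∈ T₃, ∀ y ∈ T₃, x ≠ y → D.Adj x y) :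
    (T₁ ∪ T₂ ∪ T₃)ᶜ.card * adjPairs D (T₁ ∪ T₂ ∪ T₃) + 18 * ((T₁ ∪ T₂ ∪ T₃).card + 1) +
      2 * (T₁ ∪ T₂ ∪ T₃).card * ∑ z ∈ (T₁ ∪ T₂ ∪ T₃)ᶜ, degIn D (T₁ ∪ T₂ ∪ T₃) z +
      (T₁ ∪ T₂ ∪ T₃).card * ∑ z ∈ (T₁ ∪ T₂ ∪ T₃)ᶜ, degIn D (T₁ ∪ T₂ ∪ T₃)ᶜ z ≤
    ∑ p ∈ adjPairsAll D, deficit D p + 4 * ∑ x ∈ T₁, degIn D (T₁ ∪ T₂ ∪ T₃) x +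
      4 * ∑ x ∈ T₂, degIn D (T₁ ∪ T₂ ∪ T₃) x + 4 * ∑ x ∈ T₃, degIn D (T₁ ∪ T₂ ∪ T₃) x +
      4 * ∑ z ∈ (T₁ ∪ T₂ ∪ T₃)ᶜ, ∑ x ∈ (T₁ ∪ T₂ ∪ T₃).filter (fun x => D.Adj z x), degIn D (T₁ ∪ T₂ ∪ T₃) x +
      2 * ∑ z ∈ (T₁ ∪ T₂ ∪ T₃)ᶜ, degIn D (T₁ ∪ T₂ ∪ T₃) z * degIn D (T₁ ∪ T₂ ∪ T₃) z +
      2 * ∑ z ∈ (T₁ ∪ T₂ ∪ T₃)ᶜ, degIn D (T₁ ∪ T₂ ∪ T₃) z * degIn D (T₁ ∪ T₂ ∪ T₃)ᶜ z := by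
  set S := T₁ ∪ T₂ ∪ T₃ with hS
  rw [sum_deficit_eq_sum_far, ← sum_add_sum_compl S]
  have hR : Sᶜ.card * adjPairs D S ≤ ∑ z ∈ Sᶜ, far D z +
      2 * ∑ z ∈ Sᶜ, ∑ x ∈ S.filter (fun x => D.Adj z x), degIn D S x := by
    rw [mul_sum, ← sum_add_distrib]
    have : Sᶜ.card * adjPairs D S = ∑ _z ∈ Sᶜ, adjPairs D S := by rw [sum_const, smul_eq_mul]
    rw [this]
    apply sum_le_sum
    intro z _
    exact adjPairs_le_far_add D S z
  have hSfar := sum_far_eq_double D S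
  rw [double_sum_split S] at hSfar
  have hin := block_inside_ge_three D T₁ T₂ T₃ h12 h13 h23
    (fun x y => (S.filter (fun t => ¬ D.Adj x t ∧ ¬ D.Adj y t)).card)
  have hb1 := block_clique D S T₁ h₁ (subset_union_left.trans subset_union_left) hcl₁
  have hb2 := block_clique D S T₂ h₂ (subset_union_right.trans subset_union_left) hcl₂
  have hb3 := block_clique D S T₃ h₃ subset_union_right hcl₃
  have hc := block_cross D S
  have hcs := block_cross_swap D S
  have ho := block_outside D S
  rw [← hS] at hin
  linarith

end C047

end TriangleCap

end PercRepro
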